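import Summits.Ventures.PercRepro.ProfileThreeAvgStep

/-!
# PercRepro — THE ROW `q = 3` OF (Π) FROM THE DELETION-MONOTONICITY OF THE CO-RANK-3 GAP (p10, gen 7;
`proofs/P10-AVFULL.md` §6)

For a finite matroid `N` and a level `u` write `gap(N; u) := C(u,3) · W⁻_u(N) − D₃(N; u)` with
`W⁻_u(N) = #{S : ρ(S) = u, ρ(E ∖ S) ≥ 3}` (`levelSetCo`) and `D₃(N; u) = Σ_{ρ(B) = 3} demand N 3 u B`.
The co-rank-3 row `ProfileIneqMinus N u` says `gap(N; u) ≥ 0`.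

**THE CONJECTURE OF RECORD** (`GapMono M z u`, stated without subtraction):
`D₃(M; u) + C(u,3) · W⁻_u(M ∖ z) ≤ D₃(M ∖ z; u) + C(u,3) · W⁻_u(M)`, i.e. `gap(M ∖ z; u) ≤ gap(M; u)` — deleting a
point never raises the gap.  DATA (p10 g7, own C `gpall.c` / `gprand.c` / `gpfam.c`): 0 failures at EVERY point of
EVERY matroid on `≤ 9` elements (all 383,172 classes on 9 elements, 5,173,794 `(M, u, z)` tests, loops and parallel
elements included), at every point of 34,546 random `GF(2)` / `GF(3)` instances on `10 … 13` elements and of 21 direct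
sums of uniform matroids on `≤ 16` elements; tight on the free matroid.  Nothing here asserts it.

**THEOREM** (`profileIneq_three_of_gapMonoRule`): if every finite matroid on `≥ u + 4` elements has ONE point at
which the gap is monotone, then `(Π_{3,u})` holds for every finite matroid (`u ≥ 3`) — by strong induction on `#E`
with the base `#E ≤ u + 3` (`profileIneqMinus_of_card_le`); no reduction to simple matroids is needed.
The per-point hypothesis is the co-rank-3 analogue of the cell's `GoodPoint` (ProfileThreeGoodPoint): there the
supply was `#{S ∋ z : ρ(S) = u}`, here it is `W⁻_u(M) − W⁻_u(M ∖ z) = #{S ∋ z : ρ(S) = u, ρ(E∖S) ≥ 3} +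
#{S ∌ z : ρ(S) = u, ρ(E∖S) = 3, z a coloop of E∖S}` (the LOST sets), and the data say EVERY point works, while
the plain `GoodPoint` fails at some points (the cell's «bad non-fat points»).

* `GapMono`, **`profileIneqMinus_of_gapMono`** — the induction step at a gap-monotone point;
* `GapMonoRule`, `GapMonoAll`, `gapMonoRule_of_all`;
* **`profileIneqMinus_of_gapMonoRule`**, **`profileIneq_three_of_gapMonoRule`**, `profileIneq_three_of_gapMonoAll`.
-/

open scoped Matroid

namespace PercRepro.Cogirth

open Finset ThmH Skew Shadow Profile

variable {α : Type} [DecidableEq α] {M : Matroid α} [M.Finite]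

/-- **Gap-monotonicity at `z`** (the co-rank-3 good-point condition):
`D₃(M; u) + C(u,3) · W⁻_u(M ∖ z) ≤ D₃(M ∖ z; u) + C(u,3) · W⁻_u(M)`. -/
def GapMono (M : Matroid α) [M.Finite] (z : α) (u : ℕ) : Prop :=
  ∑ B ∈ Rq M 3, demand M 3 u B + u.choose 3 * (levelSetCo (M ＼ ({z} : Set α)) u).card ≤
    ∑ B ∈ Rq (M ＼ ({z} : Set α)) 3, demand (M ＼ ({z} : Set α)) 3 u B +
      u.choose 3 * (levelSetCo M u).card

/-- **The induction step at a gap-monotone point**: the co-rank-3 row on `M ∖ z` gives it on `M`. -/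
theorem profileIneqMinus_of_gapMono {z : α} {u : ℕ} (h : GapMono M z u)
    (hdel : ProfileIneqMinus (M ＼ ({z} : Set α)) u) : ProfileIneqMinus M u := by
  unfold ProfileIneqMinus at hdel ⊢
  unfold GapMono at h
  omega

/-- **The gap-monotonicity rule**: every finite matroid on `≥ u + 4` elements has a gap-monotone point.
A CONJECTURE (data only); not asserted here. -/
def GapMonoRule (α : Type) [DecidableEq α] (u : ℕ) : Prop :=
  ∀ (N : Matroid α) [N.Finite], u + 4 ≤ (gr N).card → ∃ z ∈ gr N, GapMono N z u

/-- **Gap-monotonicity at every point of every finite matroid** — the statement the data support. -/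
def GapMonoAll (α : Type) [DecidableEq α] (u : ℕ) : Prop :=
  ∀ (N : Matroid α) [N.Finite], ∀ z ∈ gr N, GapMono N z u

/-- The all-points statement gives the rule. -/
theorem gapMonoRule_of_all {u : ℕ} (h : GapMonoAll α u) : GapMonoRule α u := by
  intro N _ hN
  have hne : (gr N).Nonempty := card_pos.1 (by omega)
  obtain ⟨z, hz⟩ := hne
  exact ⟨z, hz, h N z hz⟩

/-- **The co-rank-3 row on every finite matroid from the rule** (`u ≥ 3`): strong induction on `#E`. -/
theorem profileIneqMinus_of_gapMonoRule {u : ℕ} (hu : 3 ≤ u) (h : GapMonoRule α u)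
    (M : Matroid α) [M.Finite] : ProfileIneqMinus M u := by
  suffices hh : ∀ n : ℕ, ∀ (N : Matroid α) [N.Finite], (gr N).card = n → ProfileIneqMinus N u from
    hh _ M rfl
  intro n
  induction n using Nat.strong_induction_on with
  | _ n ih =>
  intro N _ hN
  rcases Nat.lt_or_ge (gr N).card (u + 4) with hsmall | hbig
  · exact profileIneqMinus_of_card_le hu (by omega)
  · obtain ⟨z, hz, hgm⟩ := h N hbig
    have hlt : ((gr N).erase z).card < n := by rw [← hN]; exact card_erase_lt_of_mem hz
    exact profileIneqMinus_of_gapMono hgm (ih _ hlt (N ＼ ({z} : Set α)) (by rw [gr_delete']))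

/-- **THE ROW `q = 3` OF (Π) ON EVERY FINITE MATROID FROM THE GAP-MONOTONICITY RULE** (`u ≥ 3`). -/
theorem profileIneq_three_of_gapMonoRule {u : ℕ} (hu : 3 ≤ u) (h : GapMonoRule α u)
    (M : Matroid α) [M.Finite] : ProfileIneq M 3 u :=
  profileIneq_three_of_minus hu (profileIneqMinus_of_gapMonoRule hu h M)

/-- The same from the all-points statement. -/
theorem profileIneq_three_of_gapMonoAll {u : ℕ} (hu : 3 ≤ u) (h : GapMonoAll α u)
    (M : Matroid α) [M.Finite] : ProfileIneq M 3 u :=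
  profileIneq_three_of_gapMonoRule hu (gapMonoRule_of_all h) M

end PercRepro.Cogirth
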